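import Summits.BirchSwinnertonDyer.BirchSwinnertonDyer.Theorems.TameQuarticSolventTprimeRankOneLowerVisibilityRecord235944v1Data
import HarnessLib

/-!
# Crux `SolventPairLowerBound` (item stmt-BirchSwinnertonDyer-21391, route TameQuarticSolvent — the own-curve LOWER half at `3`) and the body of TQMP
# `TprimeRankOneLowerAtThree` (item stmt-BirchSwinnertonDyer-23739) AT ONE (t′) rank-one INTRINSIC class: HYBRID kernel record `235944v1 @ 3` ← `235944a1`, part 2 — the record theorem, the `3`-congruence (Hesse certificate)
# and the binder-free END `missingLowerBoundAt_c235944v1_3` (part 1 = `…TprimeRankOneLowerVisibilityRecord235944v1Data.lean`: models, twist models, witnesses)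

FILED by the TQS lead `prover-bsd-wall-tqs-p1-g7-0` (2026-08-28) as a `--supports stmt-BirchSwinnertonDyer-21391 --as helper` record, RE-HOMED from cell `bsd-addord`, seat `bsd-addord-k1-c3` gen 8's PARKED kernel record `HOME(bsd-addord)/k1-c3/hybrid-g8/records_O_parked/AdditiveBranchIMCAdditiveThreeVisibilityHybridRecord235944v1.lean` (sha16 `f97b27897d62f988`; k1-c3 README §3: «PARKED … file with `--supports <owner item> --as helper` when an owner exists»): the mathematics, the certificates and every declaration below are k1-c3's, BYTE-IDENTICAL below this paragraph (only the file/module names and this header are re-homed). OWNER: `E = 235944v1` is one of the SEVEN intrinsic (t′) analytic-rank-one isogeny classes at `3` of Cremona's table (`N < 5·10⁵`; every member has `#Ш_an = 9`, `ρ̄_3` onto; lead g6 memo `Cruxes/SolventPairLowerBound/INTRINSIC-CORE-g6.md`, width w3 g4 `WITNESS-w3g4.md` §2/§4) — exactly the rows on which the (t′) rank-one LOWER half at `3` (TQMP 23739 = TQS 21391 modulo the rank-zero halves, p588900/p592225/p592852) has content; this record is that lower half AT THE CLASS, by Mazur visibility from the `3`-congruent rank-`3` curve `235944a1` of the same conductor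 `N`. PER CLASS; the ∀-items 21391 / 23739 stay OPEN; BSD is not proved by any of this.

Cell `bsd-addord`, seat `bsd-addord-k1-c3` (D-0074 row B2), gen 8; generated by `recordgen_hybrid.py`. Same sources, data and HONEST FRAMING as part 1
(nothing here proves BSD or the crux; THEOREMS ONLY; per pair; NOT a class theorem; nothing booked). See part 1's module docstring for the pair,
the places and their kinds, the witnesses and the certificates.
-/

set_option autoImplicit false

noncomputable section

open scoped Classical MatrixGroups ModularForm NumberField

open CongruenceSubgroup WeierstrassCurve Literature.NumberTheory.EllipticCurves
  Literature.NumberTheory.EllipticCurves.Rank1Residual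
  Literature.NumberTheory.EllipticCurves.Rank1Residual.Typed
  Literature.NumberTheory.EllipticCurves.Rank1Residual.X11RankOneCertificates
  Literature.NumberTheory.EllipticCurves.ModularForms
  Literature.NumberTheory.EllipticCurves.MazurRubin2015
  Literature.NumberTheory.EllipticCurves.Fisher2012
  Literature.NumberTheory.EllipticCurves.TateCurve
  Literature.NumberTheory.GaloisRepresentations
  Summit.BirchSwinnertonDyer.BirchSwinnertonDyer.Rank1Residual.IntModel
  Summit.BirchSwinnertonDyer.Rank1Residual.X11b
  Summit.BirchSwinnertonDyer.Rank1Residual.GaloisImage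
  Summit.BirchSwinnertonDyer.Rank1Residual.Supersingular
  Summit.BirchSwinnertonDyer.Rank1Residual.SecondDescent
open NumberField IsDedekindDomain Rat.HeightOneSpectrum Field
open Summit.BirchSwinnertonDyer.Rank1Residual.Supersingular.LocalOddTorsion

set_option linter.dupNamespace false

namespace Summit.BirchSwinnertonDyer.BirchSwinnertonDyer.Theorems.AdditiveBranchIMCGordTwoRankOneVisibility

open Summit.BirchSwinnertonDyer.Rank1Residual
open Summit.BirchSwinnertonDyer.Rank1Residual.Additive

/-- **`ord₃ #Ш(E)_an ≤ ord₃ #Ш(E)` for `E = 235944v1` (analytic rank ONE, CONTENT window) by TWO-WITNESS VISIBILITY, KERNEL RECORD, HYBRID door.**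
Named facts: Cassels–Tate (`hCT`), GZK (`hGZK`); displayed per-pair binders: `θ : F[3] ⥲ E[3]` (`F = 235944a1`), Cremona's `r_an = 1` (`hr1`)
and `ord₃ #Ш_an ≤ 2` (`hq`, `hv`); EVERYTHING ELSE IN THE KERNEL (models, `E[3]` irreducible, the local options of the two witnesses at every place of `S`
(formal-group / kind-(i) deciders / good reduction at `3`), independence mod `3F(ℚ)` from four reduction certificates, good reduction
off `S`). Door `missingLowerBoundAt_rankOne_irr_of_twoWitnesses_locallyDivisible` (cell-free; no twist model, no Mazur–Rubin).
Per pair; NOT a class theorem; nothing booked. [cite: CremonaMazur2000, §3 and Table 1] [cite: AgasheStein2002, Lemma 3.6]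
[cite: SilvermanAEC2009, Thm. IV.6.4, Prop. VII.2.1, Prop. VII.2.2, Thm. X.4.14] [cite: Cremona2006, Table 1 (Cremona labels 235944v1, 235944a1)] -/
theorem missingLowerBoundAt_c235944v1_3_of_congr
    (hCT : exists_casselsTate_pairing (K := ℚ)) (hGZK : rank_eq_analyticRank_of_analyticRank_le_one)
    {W F : WeierstrassCurve ℚ} [W.IsElliptic] [W.IsGloballyMinimal] [F.IsElliptic] [F.IsGloballyMinimal]
    (hWeq : W = ⟨0, 0, 0, 12729, 478287⟩) (hFeq : F = ⟨0, 0, 0, -2919, 60714⟩)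
    (hr1 : W.analyticRank = 1) {q : ℚ} (hq : shaAn W = (q : ℂ)) (hv : padicValRat 3 q ≤ 2)
    (θ : geomTorsion F (3 : ℤ) ≃+ geomTorsion W (3 : ℤ))
    (hθ : ∀ (σ : Field.absoluteGaloisGroup ℚ) (P : geomTorsion F (3 : ℤ)), θ (σ • P) = σ • θ P) :
    MissingLowerBoundAt W 3 := by
  haveI : Fact (Nat.Prime 3) := ⟨by norm_num⟩
  have hT1 : F.toAffine.Nonsingular ((2557 : ℚ) / 81) ((3698 : ℚ) / 729) := by
    rw [hFeq]
    haveI := isElliptic_c235944a1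
    exact WeierstrassCurve.Affine.equation_iff_nonsingular.mp ((WeierstrassCurve.Affine.equation_iff _ _).mpr (by norm_num))
  have hT2 : F.toAffine.Nonsingular ((123817 : ℚ) / 3969) ((884906 : ℚ) / 250047) := by
    rw [hFeq]
    haveI := isElliptic_c235944a1
    exact WeierstrassCurve.Affine.equation_iff_nonsingular.mp ((WeierstrassCurve.Affine.equation_iff _ _).mpr (by norm_num))
  have hTd : F.toAffine.Nonsingular ((3106510 : ℚ) / 6561) ((-5441128712 : ℚ) / 531441) := by
    rw [hFeq]
    haveI := isElliptic_c235944a1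
    exact WeierstrassCurve.Affine.equation_iff_nonsingular.mp ((WeierstrassCurve.Affine.equation_iff _ _).mpr (by norm_num))
  -- sum and difference of the witnesses as explicit points
  obtain ⟨hTs, es⟩ := sum_witnesses_c235944a1 F hFeq hT1 hT2
  obtain ⟨hT1', ed⟩ := diff_witnesses_c235944a1 F hFeq hTd hT2
  have ed' : (Affine.Point.some _ _ hT1 : F.toAffine.Point) - Affine.Point.some _ _ hT2 = Affine.Point.some _ _ hTd :=
    sub_eq_iff_eq_add.mpr ed.symm
  -- the four non-divisibilities and independence mod 3F(ℚ)
  have h1 := not_mem_range_zsmul_T1_c235944a1 F hFeq hT1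
  have h2 := not_mem_range_zsmul_T2_c235944a1 F hFeq hT2
  have hs := not_mem_range_zsmul_T1pT2_c235944a1 F hFeq hTs
  have hd := not_mem_range_zsmul_T1mT2_c235944a1 F hFeq hTd
  rw [← es] at hs
  rw [← ed'] at hd
  have hind := indep_mod_three_of_not_mem h1 h2 hs hd
  have hirr : Irr W 3 := by rw [hWeq]; exact irr_c235944v1_3
  -- integer models of W and F (the deciders' currency)
  have hIW : integralModelInt W = (⟨0, 0, 0, 12729, 478287⟩ : WeierstrassCurve ℤ) :=
    integralModelInt_eq_of_map_eq _ (by rw [hWeq]; ext <;> simp [WeierstrassCurve.map])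
  have hIF : integralModelInt F = (⟨0, 0, 0, -2919, 60714⟩ : WeierstrassCurve ℤ) :=
    integralModelInt_eq_of_map_eq _ (by rw [hFeq]; ext <;> simp [WeierstrassCurve.map])
  have hrel29 : ∀ w : HeightOneSpectrum (𝓞 ℚ), (primesEquiv w : ℕ) = 29 →
      (selmerLocalKer W (w.adicCompletion ℚ) ((3 : ℕ) : ℤ)).relIndex
        ((selmerLocalKer F (w.adicCompletion ℚ) ((3 : ℕ) : ℤ)).map (h1Equiv θ hθ).toAddMonoidHom) = 1 := by
    intro w hw
    -- kind (iii): both multiplicative, same γ-class (N/D = -28623278/51708139), μ₃(ℚ_29) = 1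
    exact DivisionDecider.relIndex_eq_one_of_kindIII_checks_of_intModel 29 (hq := ⟨by norm_num⟩)
      Silverman1994_thmV53_corV54_tateUniformisation_holds W F hIW hIF θ hθ hw
      (by decide +kernel) (by decide +kernel) (by decide +kernel) (by decide +kernel) (by decide +kernel) (by decide +kernel)
      (N := -28623278) (D := 51708139) (by decide) (by decide +kernel) (w := 0) (by decide +kernel) (by decide +kernel) (by decide +kernel)
      (w₃ := 0) (by decide +kernel) (by decide +kernel) (by decide +kernel)
  -- kind (i) places: #F(ℚ_ℓ)[3] = 1 by the kernel decider
  have h2 : ∀ w : HeightOneSpectrum (𝓞 ℚ), (primesEquiv w : ℕ) = 2 →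
      Nat.card (nsmulAddMonoidHom 3 : (F.baseChange (w.adicCompletion ℚ)).toAffine.Point →+ _).ker = 1 := by
    intro w hw
    haveI : Fact (Nat.Prime 2) := ⟨by norm_num⟩
    exact (LocalTorsion3At.free_kind_i_of_checkAt 2 0 0 0 (-2919) 60714 (by norm_num) (by decide +kernel)
      (k := 2) (cert := []) (by decide +kernel) F (by rw [hFeq]; ext <;> norm_num) hw).2
  have h113 : ∀ w : HeightOneSpectrum (𝓞 ℚ), (primesEquiv w : ℕ) = 113 →
      Nat.card (nsmulAddMonoidHom 3 : (F.baseChange (w.adicCompletion ℚ)).toAffine.Point →+ _).ker = 1 := by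
    intro w hw
    haveI : Fact (Nat.Prime 113) := ⟨by norm_num⟩
    exact (LocalTorsion3At.free_kind_i_of_checkAt 113 0 0 0 (-2919) 60714 (by norm_num) (by decide +kernel)
      (k := 1) (cert := [((100 : ℤ), 0, 1, 0)]) (by decide +kernel) F (by rw [hFeq]; ext <;> norm_num) hw).2
  -- option (a) AT 3 for both witnesses: level-2 points of the formal group (3 ∣ den x, 9 ∣ num (x/y))
  have h3a : ∀ w : HeightOneSpectrum (𝓞 ℚ), (primesEquiv w : ℕ) = 3 →
      ∃ Q : (F.baseChange (w.adicCompletion ℚ)).toAffine.Point,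
        3 • Q = WeierstrassCurve.Affine.Point.baseChange (W' := F) ℚ (w.adicCompletion ℚ) (.some _ _ hT1) := by
    intro w hw
    exact LocalDivisibility.exists_nsmul_eq_baseChange_of_dvd_den 0 0 0 (-2919) 60714 F
      (by rw [hFeq]; ext <;> norm_num) (p := 3) (ℓ := 3) (by norm_num) hw hT1 (by decide +kernel) (fun _ ↦ by decide +kernel)
  have h3b : ∀ w : HeightOneSpectrum (𝓞 ℚ), (primesEquiv w : ℕ) = 3 →
      ∃ Q : (F.baseChange (w.adicCompletion ℚ)).toAffine.Point,
        3 • Q = WeierstrassCurve.Affine.Point.baseChange (W' := F) ℚ (w.adicCompletion ℚ) (.some _ _ hT2) := by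
    intro w hw
    exact LocalDivisibility.exists_nsmul_eq_baseChange_of_dvd_den 0 0 0 (-2919) 60714 F
      (by rw [hFeq]; ext <;> norm_num) (p := 3) (ℓ := 3) (by norm_num) hw hT2 (by decide +kernel) (fun _ ↦ by decide +kernel)
  -- the prime list: every prime divisor of Δ_E, Δ_F lies in L
  set L : List ℕ := [2, 3, 29, 113] with hL
  have hLp : ∀ r ∈ L, r.Prime := by
    intro r hr; simp only [hL, List.mem_cons, List.mem_nil_iff, or_false] at hr
    rcases hr with rfl | rfl | rfl | rfl <;> norm_num
  have hΔE : ∀ r : ℕ, r.Prime → (r : ℤ) ∣ (⟨0, 0, 0, 12729, 478287⟩ : WeierstrassCurve ℤ).Δ → r ∈ L :=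
    forall_mem_of_natAbs_eq_prod_pow L [4, 3, 1, 5] hLp (by decide +kernel)
  have hΔF : ∀ r : ℕ, r.Prime → (r : ℤ) ∣ (⟨0, 0, 0, -2919, 60714⟩ : WeierstrassCurve ℤ).Δ → r ∈ L :=
    forall_mem_of_natAbs_eq_prod_pow L [8, 3, 2, 1] hLp (by decide +kernel)
  -- the set of places S (over L)
  set e := primesEquiv (R := 𝓞 ℚ) with he
  set S : Finset (HeightOneSpectrum (𝓞 ℚ)) :=
    (L.filterMap fun r ↦ if h : r.Prime then some (e.symm ⟨r, h⟩) else none).toFinset with hSdef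
  have hmemS : ∀ w : HeightOneSpectrum (𝓞 ℚ), w ∈ S ↔ (e w : ℕ) ∈ L := by
    intro w
    rw [hSdef, List.mem_toFinset, List.mem_filterMap]
    constructor
    · rintro ⟨r, hr, hrw⟩
      by_cases hrp : r.Prime
      · rw [dif_pos hrp, Option.some.injEq] at hrw
        rw [← hrw, Equiv.apply_symm_apply]
        exact hr
      · rw [dif_neg hrp] at hrw
        exact absurd hrw (by simp)
    · intro hw
      refine ⟨(e w : ℕ), hw, ?_⟩
      rw [dif_pos (e w).2]
      simp
  -- good reduction outside S
  have hS : ∀ w : HeightOneSpectrum (𝓞 ℚ), w ∉ S →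
      W.HasGoodReductionAt w ∧ F.HasGoodReductionAt w ∧ (((3 : ℕ) : ℕ) : 𝓞 ℚ) ∉ w.asIdeal := by
    intro w hwS
    have hwL : (e w : ℕ) ∉ L := fun h ↦ hwS ((hmemS w).mpr h)
    have hqp : (e w : ℕ).Prime := (e w).2
    refine ⟨?_, ?_, natCast_not_mem_of_primesEquiv_ne w Fact.out fun h ↦ hwL ?_⟩
    · rw [hWeq]; exact hasGoodReductionAt_mk_of_primesEquiv _ _ _ _ _ w rfl fun h ↦ hwL (hΔE _ hqp h)
    · rw [hFeq]; exact hasGoodReductionAt_mk_of_primesEquiv _ _ _ _ _ w rfl fun h ↦ hwL (hΔF _ hqp h)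
    · show (primesEquiv w : ℕ) ∈ L
      rw [h]; decide
  have hdiv : ∀ P ∈ [(Affine.Point.some _ _ hT1 : F.toAffine.Point), Affine.Point.some _ _ hT2], ∀ w ∈ S,
      (∃ Q : (F.baseChange (w.adicCompletion ℚ)).toAffine.Point,
        3 • Q = WeierstrassCurve.Affine.Point.baseChange (W' := F) ℚ (w.adicCompletion ℚ) P) ∨
      ((((3 : ℕ) : ℕ) : 𝓞 ℚ) ∉ w.asIdeal ∧ Nat.card (nsmulAddMonoidHom 3 :
          (F.baseChange (w.adicCompletion ℚ)).toAffine.Point →+ _).ker = 1) ∨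
      ((selmerLocalKer W (w.adicCompletion ℚ) ((3 : ℕ) : ℤ)).relIndex
        ((selmerLocalKer F (w.adicCompletion ℚ) ((3 : ℕ) : ℤ)).map (h1Equiv θ hθ).toAddMonoidHom) = 1) := by
    intro P hP w hwS
    have hwL : (e w : ℕ) ∈ L := (hmemS w).mp hwS
    simp only [List.mem_cons, List.mem_nil_iff, or_false] at hP
    have hcases : (e w : ℕ) = 2 ∨ (e w : ℕ) = 3 ∨ (e w : ℕ) = 29 ∨ (e w : ℕ) = 113 := by
      simp only [hL, List.mem_cons, List.mem_nil_iff, or_false] at hwL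
      omega
    rcases hcases with hw | hw | hw | hw
    · -- 2: kind (i)
      exact Or.inr (Or.inl ⟨natCast_not_mem_of_primesEquiv_ne w Fact.out (by rw [hw]; decide), h2 w hw⟩)
    · -- 3 = p: option (a) for each witness
      rcases hP with rfl | rfl
      · exact Or.inl (h3a w hw)
      · exact Or.inl (h3b w hw)
    · -- 29: kind (iii), agreement ι(θ) = 1 by the kernel decider
      exact Or.inr (Or.inr (hrel29 w hw))
    · -- 113: kind (i)
      exact Or.inr (Or.inl ⟨natCast_not_mem_of_primesEquiv_ne w Fact.out (by rw [hw]; decide), h113 w hw⟩)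
  exact missingLowerBoundAt_rankOne_irr_of_twoWitnesses_hybrid hCT hGZK (by norm_num) hirr hr1 hq hv F θ hθ S hS
    (Affine.Point.some _ _ hT1) (Affine.Point.some _ _ hT2) hind hdiv

/-- **The `3`-congruence `235944a1[3] ≅ 235944v1[3]` PROVED IN THE KERNEL** (no named fact): `F` is the member `(λ : μ) = (6742 : 5)` of the DUAL Hesse pencil `X_E⁻(3)` (Fisher 2012 §13) of `E`,
`u = 1/72` (`c₄(E) = -610992`, `c₆(E) = -413239968`, `c₄(F) = 140112`, `c₆(F) = -52456896`): the two covariant identities are `norm_num` on the tree's closed forms and fed to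
`Fisher2012.threeCongruent_of_dualHesseCertificate_unconditional`; certificate by the seat's exact finder `find_hesse3.py` (k1-c3 g8).
[cite: Fisher2012Hessian, Thm. 13.2 and §13 (n = 3)] [cite: Cremona2006, Table 1 (Cremona labels 235944v1, 235944a1)] -/
theorem threeCongruent_c235944v1_c235944a1 (W : WeierstrassCurve ℚ) [W.IsElliptic] (hWeq : W = ⟨0, 0, 0, 12729, 478287⟩) :
    ∃ θ : geomTorsion (⟨0, 0, 0, -2919, 60714⟩ : WeierstrassCurve ℚ) (3 : ℤ) ≃+ geomTorsion W (3 : ℤ),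
      ∀ (σ : Field.absoluteGaloisGroup ℚ) (P : geomTorsion (⟨0, 0, 0, -2919, 60714⟩ : WeierstrassCurve ℚ) (3 : ℤ)), θ (σ • P) = σ • θ P := by
  haveI := isElliptic_c235944a1
  have hc4 : W.c₄ = (-610992 : ℚ) := by
    subst hWeq; norm_num [WeierstrassCurve.c₄, WeierstrassCurve.b₂, WeierstrassCurve.b₄]
  have hc6 : W.c₆ = (-413239968 : ℚ) := by
    subst hWeq; norm_num [WeierstrassCurve.c₆, WeierstrassCurve.b₂, WeierstrassCurve.b₄, WeierstrassCurve.b₆]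
  have hc4F : (⟨0, 0, 0, -2919, 60714⟩ : WeierstrassCurve ℚ).c₄ = (140112 : ℚ) := by
    norm_num [WeierstrassCurve.c₄, WeierstrassCurve.b₂, WeierstrassCurve.b₄]
  have hc6F : (⟨0, 0, 0, -2919, 60714⟩ : WeierstrassCurve ℚ).c₆ = (-52456896 : ℚ) := by
    norm_num [WeierstrassCurve.c₆, WeierstrassCurve.b₂, WeierstrassCurve.b₄, WeierstrassCurve.b₆]
  exact threeCongruent_of_dualHesseCertificate_unconditional W (⟨0, 0, 0, -2919, 60714⟩ : WeierstrassCurve ℚ)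
    (6742 : ℚ) (5 : ℚ) ((1 : ℚ) / 72) (by norm_num)
    (by rw [hc4, hc6, hc4F, eval_hesseD3]; norm_num) (by rw [hc4, hc6, hc6F, eval_hesseC6three]; norm_num)

/-- **`ord₃ #Ш(E)_an ≤ ord₃ #Ш(E)` for `E = 235944v1` (the crux's conclusion AT THE PAIR), binders `hCT hGZK`, the model `hWeq`, Cremona's `r_an = 1`
and `#Ш(E)_an = q`, `ord₃ q ≤ 2` ONLY** — partner, witnesses, places AND the `3`-congruence in the kernel (`missingLowerBoundAt_c235944v1_3_of_congr` +
`threeCongruent_c235944v1_c235944a1`). Per pair; NOT a class theorem; nothing booked. [cite: CremonaMazur2000, §3] [cite: AgasheStein2002, Lemma 3.6]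
[cite: Fisher2012Hessian, Thm. 13.2 and §13 (n = 3)] [cite: Cremona2006, Table 1 (Cremona labels 235944v1, 235944a1)] -/
theorem missingLowerBoundAt_c235944v1_3
    (hCT : exists_casselsTate_pairing (K := ℚ)) (hGZK : rank_eq_analyticRank_of_analyticRank_le_one)
    {W : WeierstrassCurve ℚ} [W.IsElliptic] [W.IsGloballyMinimal] (hWeq : W = ⟨0, 0, 0, 12729, 478287⟩)
    (hr1 : W.analyticRank = 1) {q : ℚ} (hq : shaAn W = (q : ℂ)) (hv : padicValRat 3 q ≤ 2) :
    MissingLowerBoundAt W 3 := by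
  haveI := isElliptic_c235944a1
  haveI := isGloballyMinimal_c235944a1
  obtain ⟨θ, hθ⟩ := threeCongruent_c235944v1_c235944a1 W hWeq
  exact missingLowerBoundAt_c235944v1_3_of_congr (F := (⟨0, 0, 0, -2919, 60714⟩ : WeierstrassCurve ℚ)) hCT hGZK hWeq rfl hr1 hq hv θ hθ

end Summit.BirchSwinnertonDyer.BirchSwinnertonDyer.Theorems.AdditiveBranchIMCGordTwoRankOneVisibility

end
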